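import Summits.QuantumFields.YangMills.Theorems.BalabanUVNodesN07SymAxialRadialDefectOfBoxPlaquettes
import Summits.QuantumFields.YangMills.Theorems.BalabanUVNodesN07TwoAxialTowersPointwiseOsc
import Literature.MathematicalPhysics.QuantumFieldTheory.Balaban1983to89.BlockAveragingSectionAction
import HarnessLib

/-!
# N07 [B11] (= [15] = [Balaban1985Variational]) Sect. F ∕ [I] (0.1)–(0.11) ∕ [6] (1.15), (1.19) — **THE TORUS TOWER STATEMENT FOR `τ_T = g₁·g₂⁻¹` (sym-axial `g₁`, radial-axial `g₂`)
# FROM THE FINE BOX PLAQUETTES, END TO END BY NAME** — the (σ2) supplier of the junction, assembled on the torus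

Cell `pub-ymgap`, width seat `pub-ymgap-dag-n07-w3` g13 (junction side of the K0 road; (σ2)).  `--kind proof --supports stmt-QuantumFields-20541 --as helper` (K0⁷; count-neutral; THEOREMS
ONLY, 0 `def`).  [I] = [Balaban1987RG1]; [3] = [Balaban1985Averaging]; [6] = [Balaban1985RegularSpaces]; [15] = [Balaban1985Variational].  CONSUMED BY NAME: this seat's ✓p755647
`…N07SymAxialRadialDefectOfBoxPlaquettes.dist1_radialHol_iter_gaugeAct_le_of_fineBoxPlaqs` (itself mine ✓p754286∕516∕873 ∘ dag-n07-e ✓p754897 (126) ∘ ✓p755199 (127)) and ✓p756047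
`…N07TwoAxialTowersPointwiseOsc.{dist1_descent_le, dist1_descent_le_geom}`; g9's ✓`…N07RadialHolCoverLift.radialHol_emb`; `Balaban3D.Carriers.{radialHol, radialContourData}`;
`BlockAveragingSectionAction.blockSite_blockOf_offsets`; `B5Eq118OneStroke.iterBlockOf`; `B15DeterminingSets.embIter`; `Setup.AxialGauge`.

WHY.  The junction's first cross-term factor is the lift of the torus transformation `τ_T := g₁·g₂⁻¹` between the residual `symCd`-AXIAL tower gauge `g₁ = h̄_s·w_s` and the crown's
RADIAL-axial tower gauge `g₂ = h̄_r·w_r` of the same field `U`.  ✓p756047 controls `τ_T` POINTWISE along the block tower of every fine site from the two per-level TREE-TRANSPORTER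
DEFECTS `δ₁(n)` (of `M^n(U^{g₁})`) and `δ₂(n)` (of `M^n(U^{g₂})`); ✓p755647 bounds `δ₁(n)` by `8σ′(a(n))` from the box plaquette letter of the FINE field under the block (via 127 ∘ 126 ∘
the `symCd` tree-defect lemma); and `δ₂ ≡ 0` because the radial transporter of a radially axial field IS `1` (`AxialGauge (radialContourData …)` off the centre, `radialHol_emb` at the
centre).  THIS FILE composes the three BY NAME into the torus tower statement «`∀ t ≤ k, ∀ w ∈ S, dist1 (τ_T(embIter t (iterBlockOf t w))⁻¹·τ_T(w)) ≤ Σ_{m<t} 8σ′(a(m))`» (and its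
geometric edition `≤ ω·θ^{k−t}` under the displayed schedule `8σ′(a(m)) ≤ (ω∕2)·θ^{k−(m+1)}`), which is EXACTLY the `hT` binder of this seat's `…N07TowerOscCoverBridge.hpt_lift_of_torus_tower(_geom)`
(p756624-series) ∕ ✓p756357 `pointwise_osc_lift_of_torus`.  The only new content is index bookkeeping: `iterBlockOf n w` is the block site `blockSite (iterBlockOf (n+1) w) (offsets ·)` of its
own block, the block is `castSite t` for the representative `t` carried by the box hypothesis, and the centre case is `radialHol_emb`.  NO estimate of [I]∕[3]∕[6]∕[15] is asserted.

WHAT IS PROVED (sorry-free; every member `F.P K` of a `T4Family`, `SU(N)`, `N ≥ 1`).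
§1 `dist1_radialHol_iterBlockOf_eq_zero_of_axialGauge_radial` (any `Params`, any `GaugeGroup`): radial axiality ⇒ `dist1 (W(Γ_{ȳ(w), y(w)})) = 0` along the tower (`δ₂ ≡ 0`).
§2 ★★ `dist1_radialHol_iterBlockOf_le_of_fineBoxPlaqs`: `symCd`-axial `M^n(U^{g})`, fine plaquettes within `a₀` of `1` on the box under the block `castSite t = iterBlockOf (n+1) w`, the numerics of
   127∕126∕✓p755647 ⇒ `dist1 (M^n(U^{g})(Γ_{iterBlockOf (n+1) w, iterBlockOf n w})) ≤ 4·(2σ′(a))` (centre case included).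
§3 ★★★ `tower_statement_of_fineBoxPlaqs` (sum edition, via ✓p756047 `dist1_descent_le`) and ★★★ `tower_statement_geom_of_fineBoxPlaqs` (geometric edition `ω·θ^{k−t}`, via
   `dist1_descent_le_geom`, schedule `4·(2σ′(a m)) ≤ (ω∕2)·θ^{k−(m+1)}` displayed): the torus tower statement for `τ_T = g₁·g₂⁻¹` from (i) `symCd`-axiality of `M^n(U^{g₁})` (`n < k`),
   (ii) radial axiality of `M^n(U^{g₂})` (`n < k`), (iii) ONE fine plaquette letter `PlaqSmallOn S₀ a₀ U` on a set containing the box plaquettes under every block of the towers over `S`,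
   (iv) the per-level numerics with a displayed letter schedule `a : ℕ → ℝ`.
HONEST FRAMING: count-neutral helper; three compositions and index bookkeeping — nothing of [I]∕[3]∕[6]∕[15] asserted or discharged; the fine plaquette letter (row (17) of the datum), the
two axialities (the carriers) and the numeric schedule remain DISPLAYED hypotheses of the junction's knit; `NrmSymPhiOfRecord` ∕ `HThm4RecSym152PhiE(G)` ∕ `HThm4Rec*` UNDISCHARGED; N05 ∕ N07
NOT discharged; K0⁷ ∕ K1⁹ NOT closed; counts unmoved (typed 28∕28 · discharged 8∕28); one finite 𝕋⁴ programme at fixed ε — R4 closes the conditional finite-𝕋⁴ rung `BalabanLadder.UV` only;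
the YM mass gap (Clay) is NOT proved by any of this; nothing continuum ∕ ℝ⁴ ∕ OS.  No `def`, no `instance`, no `notation`, no `sorry`.

References: [I] (0.1) p. 251, (0.3)–(0.4) pp. 252–253, (0.5)–(0.7) p. 253, (0.11) p. 253; [3] (8) p. 18, (11) p. 19; [6] (1.15) p. 78, (1.19) p. 79, (1.132) p. 99; [15] (147)–(154) pp. 301–302.
-/

set_option autoImplicit false

noncomputable section

open scoped BigOperators

namespace Summit.QuantumFields.YangMills.BalabanUVNodes.N07SymTauTowerStatementOfFinePlaquettes

open Literature.MathematicalPhysics.QuantumFieldTheory.Balaban1983to89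
open Literature.MathematicalPhysics.QuantumFieldTheory.Balaban1983to89.Node00
open T4Continuum (T4Family transfUp iter_gaugeAct)
open T4AxialGaugeSmallField (castSite boxPlaqs)
open B14DomainGeom (Pt)
open GaugeField (gaugeAct)
open ExpMeanLog (expMeanLogSU deltaSU)
open B5Eq118OneStroke (iterBlockOf iterBlockOf_succ)
open B15DeterminingSets (embIter)
open BlockAveragingSectionAction (offsets blockSite_blockOf_offsets)
open Summit.QuantumFields.Balaban3D.Carriers (radialHol radialContourData radialContourData_holTo)
open Summit.QuantumFields.YangMills.BalabanUVNodes.N07NormalisationSymOfRecord (symCd)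
open Summit.QuantumFields.YangMills.BalabanUVNodes.N07RadialHolCoverLift (radialHol_emb)
open Summit.QuantumFields.YangMills.BalabanUVNodes.N07SymAxialRadialDefectOfBoxPlaquettes (dist1_radialHol_iter_gaugeAct_le_of_fineBoxPlaqs)
open Summit.QuantumFields.YangMills.BalabanUVNodes.N07TwoAxialTowersPointwiseOsc (dist1_descent_le dist1_descent_le_geom)

variable {F : T4Family} {N : ℕ} [NeZero N]

/-! ## §1  Radial axiality: the radial transporter along the tower is `1` (`δ₂ ≡ 0`) -/

/-- **`δ₂ ≡ 0`**: if `W` is radially axial at level `n` (`AxialGauge (radialContourData P n G) W`), then along the block tower of any fine site `w` the radial transporter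
`W(Γ_{iterBlockOf (n+1) w, iterBlockOf n w})` is `1` — off the centre by the axial gauge condition, at the centre by `radialHol_emb` — so its `dist1` is `0`.
[cite: Balaban1987RG1, (0.3)–(0.4) pp.252–253; Balaban1985RegularSpaces, (1.19) p.79] -/
theorem dist1_radialHol_iterBlockOf_eq_zero_of_axialGauge_radial {P : Params} {G : Type*} [GaugeGroup G] {n : ℕ} (hn : n + 1 ≤ P.m + P.K)
    (W : GaugeField P n G) (hax : AxialGauge (radialContourData P n G) W) (w : Site P 0) :
    dist1 (radialHol W (iterBlockOf (n + 1) w) (iterBlockOf n w)) = 0 := by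
  by_cases hctr : iterBlockOf n w = emb (iterBlockOf (n + 1) w)
  · rw [hctr, radialHol_emb hn, GaugeGroup.dist1_one]
  · have h := hax (iterBlockOf (n + 1) w) (iterBlockOf n w) rfl hctr
    rw [radialContourData_holTo] at h
    rw [h, GaugeGroup.dist1_one]

/-! ## §2  `symCd` axiality: the radial transporter along the tower from the fine box plaquettes (`δ₁`) -/

/-- ★★ **`δ₁(n)` ALONG THE TOWER FROM THE FINE BOX PLAQUETTES** — ✓p755647 `dist1_radialHol_iter_gaugeAct_le_of_fineBoxPlaqs` read at the tower pair
`(iterBlockOf (n+1) w, iterBlockOf n w)`: the lower site is the block site `blockSite (iterBlockOf (n+1) w) (offsets (iterBlockOf n w))` of its own block, the block is `castSite t` for the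
representative `t` of the box hypothesis, and the centre case is `radialHol_emb`.  Hypotheses and numerics VERBATIM those of ✓p755647.
[cite: Balaban1987RG1, (0.3) p.252, (0.5)–(0.7) p.253, (0.11) p.253; Balaban1985Variational, (147) p.301; Balaban1985RegularSpaces, (1.15) p.78; Balaban1985Averaging, (8) p.18] -/
theorem dist1_radialHol_iterBlockOf_le_of_fineBoxPlaqs {K n : ℕ} (hn : n + 1 ≤ (F.P K).m + (F.P K).K) (U : GaugeField (F.P K) 0 (SU N)) (g : GaugeTransf (F.P K) 0 (SU N))
    (hax : AxialGauge (symCd F N K n) (Averaging.iter (avOfRecord F N K) n (gaugeAct g U))) (hN : (F.P K).L < (F.P K).sitesPerDir n)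
    {a₀ : ℝ} (ha₀ : 0 ≤ a₀) {S₀ : Set (Plaq (F.P K) 0)} (hU : PlaqSmallOn S₀ a₀ U)
    (w : Site (F.P K) 0) (t : Fin (F.P K).d → ℤ) (ht : (castSite t : Site (F.P K) (n + 1)) = iterBlockOf (n + 1) w)
    (hS₀ : boxPlaqs (fun i => ((F.P K).L : ℤ) ^ (n + 1) * t i) (fun i => ((F.P K).L : ℤ) ^ (n + 1) * t i + (((F.P K).L : ℤ) ^ (n + 1) - 1)) ⊆ S₀)
    (hbud : 6400 * ((((F.P K).d + 2) * (F.P K).L : ℕ) : ℝ) ^ 2 * ((F.P K).L : ℝ) ^ (n + 1) * (((((F.P K).d - 1 : ℕ) : ℝ)) * ((((F.P K).L ^ (n + 1) - 1 : ℕ) : ℝ)) * a₀) ≤ 1)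
    (hgd : 30 * ((((F.P K).d + 2) * (F.P K).L : ℕ) : ℝ) ^ 2 * ((F.P K).L : ℝ) ^ (n + 1) * (((((F.P K).d - 1 : ℕ) : ℝ)) * ((((F.P K).L ^ (n + 1) - 1 : ℕ) : ℝ)) * a₀) < deltaSU (Fin N))
    {a : ℝ} (ha : 0 ≤ a) (haa : 120 * ((((F.P K).d + 2) * (F.P K).L : ℕ) : ℝ) * ((F.P K).L : ℝ) ^ n * (((((F.P K).d - 1 : ℕ) : ℝ)) * ((((F.P K).L ^ (n + 1) - 1 : ℕ) : ℝ)) * a₀) < a)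
    (h100 : 2 * ((((F.P K).d * (((F.P K).L - 1) / 2) : ℕ) : ℝ) * (((((F.P K).d - 1 : ℕ) : ℝ) * (((F.P K).L - 1 : ℕ) : ℝ)) * a)) ≤ 1 / 100)
    (hguard : 2 * ((((F.P K).d * (((F.P K).L - 1) / 2) : ℕ) : ℝ) * (((((F.P K).d - 1 : ℕ) : ℝ) * (((F.P K).L - 1 : ℕ) : ℝ)) * a)) < (FederbushMean.federbushSU (n := Fin N)).δ) :
    dist1 (radialHol (Averaging.iter (avOfRecord F N K) n (gaugeAct g U)) (iterBlockOf (n + 1) w) (iterBlockOf n w)) ≤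
      4 * (2 * ((((F.P K).d * (((F.P K).L - 1) / 2) : ℕ) : ℝ) * (((((F.P K).d - 1 : ℕ) : ℝ) * (((F.P K).L - 1 : ℕ) : ℝ)) * a))) := by
  by_cases hctr : iterBlockOf n w = emb (iterBlockOf (n + 1) w)
  · rw [hctr, radialHol_emb hn, GaugeGroup.dist1_one]
    positivity
  · have hx : Site.blockSite (iterBlockOf (n + 1) w) (offsets (iterBlockOf n w)) = iterBlockOf n w :=
      blockSite_blockOf_offsets hn (iterBlockOf n w)
    have hxy : Site.blockSite (castSite t : Site (F.P K) (n + 1)) (offsets (iterBlockOf n w)) ≠ emb (castSite t : Site (F.P K) (n + 1)) := by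
      rw [ht, hx]; exact hctr
    have key := dist1_radialHol_iter_gaugeAct_le_of_fineBoxPlaqs hn U g hax hN t ha₀ hS₀ hU hbud hgd ha haa h100 hguard (offsets (iterBlockOf n w)) hxy
    rw [ht, hx] at key
    exact key

/-! ## §3  The torus tower statement for `τ_T = g₁·g₂⁻¹` -/

/-- ★★★ **THE TORUS TOWER STATEMENT FROM THE FINE BOX PLAQUETTES (sum edition)** — for an `SU(N)` field `U` on a family member, two gauges `g₁` (`M^n(U^{g₁})` `symCd`-axial for `n < k`) and
`g₂` (`M^n(U^{g₂})` radially axial for `n < k`), a fine site set `S`, one fine plaquette letter `PlaqSmallOn S₀ a₀ U` on a plaquette set containing the box plaquettes under every block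
`iterBlockOf (n+1) w` (`w ∈ S`, `n < k`, representative `t` displayed), and the per-level numerics of ✓p755647 for a displayed letter schedule `a : ℕ → ℝ`: for every `t ≤ k` and `w ∈ S`,
`dist1 (τ_T(embIter t (iterBlockOf t w))⁻¹·τ_T(w)) ≤ Σ_{m<t} 4·(2σ′(a m))`, `τ_T := g₁·g₂⁻¹` — ✓p756047 `dist1_descent_le` with `δ₁ :=` §2 and `δ₂ := 0` (§1).
[cite: Balaban1987RG1, (0.1) p.251, (0.3)–(0.4) pp.252–253, (0.11) p.253; Balaban1985RegularSpaces, (1.15) p.78, (1.19) p.79, (1.132) p.99; Balaban1985Averaging, (11) p.19; Balaban1985Variational, (147)–(154) pp.301–302] -/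
theorem tower_statement_of_fineBoxPlaqs {K k : ℕ} (hk : k ≤ (F.P K).m + (F.P K).K) (U : GaugeField (F.P K) 0 (SU N)) (g₁ g₂ : GaugeTransf (F.P K) 0 (SU N))
    (S : Set (Site (F.P K) 0))
    (hax₁ : ∀ n, n < k → AxialGauge (symCd F N K n) (Averaging.iter (avOfRecord F N K) n (gaugeAct g₁ U)))
    (hax₂ : ∀ n, n < k → AxialGauge (radialContourData (F.P K) n (SU N)) (Averaging.iter (avOfRecord F N K) n (gaugeAct g₂ U)))
    (hN : ∀ n, n < k → (F.P K).L < (F.P K).sitesPerDir n)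
    {a₀ : ℝ} (ha₀ : 0 ≤ a₀) {S₀ : Set (Plaq (F.P K) 0)} (hU : PlaqSmallOn S₀ a₀ U)
    (hS₀ : ∀ n, n < k → ∀ w ∈ S, ∃ t : Fin (F.P K).d → ℤ, (castSite t : Site (F.P K) (n + 1)) = iterBlockOf (n + 1) w ∧
      boxPlaqs (fun i => ((F.P K).L : ℤ) ^ (n + 1) * t i) (fun i => ((F.P K).L : ℤ) ^ (n + 1) * t i + (((F.P K).L : ℤ) ^ (n + 1) - 1)) ⊆ S₀)
    (a : ℕ → ℝ) (ha : ∀ n, 0 ≤ a n)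
    (hbud : ∀ n, n < k →
      6400 * ((((F.P K).d + 2) * (F.P K).L : ℕ) : ℝ) ^ 2 * ((F.P K).L : ℝ) ^ (n + 1) * (((((F.P K).d - 1 : ℕ) : ℝ)) * ((((F.P K).L ^ (n + 1) - 1 : ℕ) : ℝ)) * a₀) ≤ 1)
    (hgd : ∀ n, n < k →
      30 * ((((F.P K).d + 2) * (F.P K).L : ℕ) : ℝ) ^ 2 * ((F.P K).L : ℝ) ^ (n + 1) * (((((F.P K).d - 1 : ℕ) : ℝ)) * ((((F.P K).L ^ (n + 1) - 1 : ℕ) : ℝ)) * a₀) < deltaSU (Fin N))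
    (haa : ∀ n, n < k →
      120 * ((((F.P K).d + 2) * (F.P K).L : ℕ) : ℝ) * ((F.P K).L : ℝ) ^ n * (((((F.P K).d - 1 : ℕ) : ℝ)) * ((((F.P K).L ^ (n + 1) - 1 : ℕ) : ℝ)) * a₀) < a n)
    (h100 : ∀ n, n < k → 2 * ((((F.P K).d * (((F.P K).L - 1) / 2) : ℕ) : ℝ) * (((((F.P K).d - 1 : ℕ) : ℝ) * (((F.P K).L - 1 : ℕ) : ℝ)) * a n)) ≤ 1 / 100)
    (hguard : ∀ n, n < k →
      2 * ((((F.P K).d * (((F.P K).L - 1) / 2) : ℕ) : ℝ) * (((((F.P K).d - 1 : ℕ) : ℝ) * (((F.P K).L - 1 : ℕ) : ℝ)) * a n)) < (FederbushMean.federbushSU (n := Fin N)).δ) :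
    ∀ t, t ≤ k → ∀ w ∈ S,
      dist1 ((g₁ (embIter t (iterBlockOf t w)) * (g₂ (embIter t (iterBlockOf t w)))⁻¹)⁻¹ * (g₁ w * (g₂ w)⁻¹)) ≤
        ∑ m ∈ Finset.range t, 4 * (2 * ((((F.P K).d * (((F.P K).L - 1) / 2) : ℕ) : ℝ) * (((((F.P K).d - 1 : ℕ) : ℝ) * (((F.P K).L - 1 : ℕ) : ℝ)) * a m))) := by
  have h₁ : ∀ n, n < k → ∀ w ∈ S, dist1 (radialHol (Averaging.iter (avOfRecord F N K) n (gaugeAct g₁ U)) (iterBlockOf (n + 1) w) (iterBlockOf n w)) ≤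
      4 * (2 * ((((F.P K).d * (((F.P K).L - 1) / 2) : ℕ) : ℝ) * (((((F.P K).d - 1 : ℕ) : ℝ) * (((F.P K).L - 1 : ℕ) : ℝ)) * a n))) := by
    intro n hn w hw
    obtain ⟨t, ht, hbox⟩ := hS₀ n hn w hw
    exact dist1_radialHol_iterBlockOf_le_of_fineBoxPlaqs (by omega) U g₁ (hax₁ n hn) (hN n hn) ha₀ hU w t ht hbox (hbud n hn) (hgd n hn) (ha n) (haa n hn)
      (h100 n hn) (hguard n hn)
  have h₂ : ∀ n, n < k → ∀ w ∈ S, dist1 (radialHol (Averaging.iter (avOfRecord F N K) n (gaugeAct g₂ U)) (iterBlockOf (n + 1) w) (iterBlockOf n w)) ≤ (0 : ℝ) :=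
    fun n hn w _ => (dist1_radialHol_iterBlockOf_eq_zero_of_axialGauge_radial (by omega) _ (hax₂ n hn) w).le
  have h := dist1_descent_le (avOfRecord F N K) hk g₁ g₂ U S
    (fun m => 4 * (2 * ((((F.P K).d * (((F.P K).L - 1) / 2) : ℕ) : ℝ) * (((((F.P K).d - 1 : ℕ) : ℝ) * (((F.P K).L - 1 : ℕ) : ℝ)) * a m)))) (fun _ => (0 : ℝ)) h₁ h₂
  intro t ht w hw
  simpa only [zero_add] using h t ht w hw

/-- ★★★ **THE TORUS TOWER STATEMENT FROM THE FINE BOX PLAQUETTES (geometric edition)** — the same with ✓p756047 `dist1_descent_le_geom`: under the displayed schedule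
`4·(2σ′(a m)) ≤ (ω∕2)·θ^{k−(m+1)}` (`m < k`; `0 ≤ θ ≤ 1∕2`, `0 ≤ ω`), for every `t ≤ k` and `w ∈ S`: `dist1 (τ_T(embIter t (iterBlockOf t w))⁻¹·τ_T(w)) ≤ ω·θ^{k−t}` — EXACTLY the `hT`
binder of this seat's `…N07TowerOscCoverBridge.hpt_lift_of_torus_tower_geom` for `τ_T := fun x => g₁ x·(g₂ x)⁻¹`.
[cite: Balaban1987RG1, (0.1) p.251, (0.3)–(0.4) pp.252–253, (0.11) p.253; Balaban1985RegularSpaces, (1.15) p.78, (1.19) p.79, (1.132) p.99; Balaban1985Averaging, (11) p.19; Balaban1985Variational, (147)–(154) pp.301–302] -/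
theorem tower_statement_geom_of_fineBoxPlaqs {K k : ℕ} (hk : k ≤ (F.P K).m + (F.P K).K) (U : GaugeField (F.P K) 0 (SU N)) (g₁ g₂ : GaugeTransf (F.P K) 0 (SU N))
    (S : Set (Site (F.P K) 0))
    (hax₁ : ∀ n, n < k → AxialGauge (symCd F N K n) (Averaging.iter (avOfRecord F N K) n (gaugeAct g₁ U)))
    (hax₂ : ∀ n, n < k → AxialGauge (radialContourData (F.P K) n (SU N)) (Averaging.iter (avOfRecord F N K) n (gaugeAct g₂ U)))
    (hN : ∀ n, n < k → (F.P K).L < (F.P K).sitesPerDir n)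
    {a₀ : ℝ} (ha₀ : 0 ≤ a₀) {S₀ : Set (Plaq (F.P K) 0)} (hU : PlaqSmallOn S₀ a₀ U)
    (hS₀ : ∀ n, n < k → ∀ w ∈ S, ∃ t : Fin (F.P K).d → ℤ, (castSite t : Site (F.P K) (n + 1)) = iterBlockOf (n + 1) w ∧
      boxPlaqs (fun i => ((F.P K).L : ℤ) ^ (n + 1) * t i) (fun i => ((F.P K).L : ℤ) ^ (n + 1) * t i + (((F.P K).L : ℤ) ^ (n + 1) - 1)) ⊆ S₀)
    (a : ℕ → ℝ) (ha : ∀ n, 0 ≤ a n)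
    (hbud : ∀ n, n < k →
      6400 * ((((F.P K).d + 2) * (F.P K).L : ℕ) : ℝ) ^ 2 * ((F.P K).L : ℝ) ^ (n + 1) * (((((F.P K).d - 1 : ℕ) : ℝ)) * ((((F.P K).L ^ (n + 1) - 1 : ℕ) : ℝ)) * a₀) ≤ 1)
    (hgd : ∀ n, n < k →
      30 * ((((F.P K).d + 2) * (F.P K).L : ℕ) : ℝ) ^ 2 * ((F.P K).L : ℝ) ^ (n + 1) * (((((F.P K).d - 1 : ℕ) : ℝ)) * ((((F.P K).L ^ (n + 1) - 1 : ℕ) : ℝ)) * a₀) < deltaSU (Fin N))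
    (haa : ∀ n, n < k →
      120 * ((((F.P K).d + 2) * (F.P K).L : ℕ) : ℝ) * ((F.P K).L : ℝ) ^ n * (((((F.P K).d - 1 : ℕ) : ℝ)) * ((((F.P K).L ^ (n + 1) - 1 : ℕ) : ℝ)) * a₀) < a n)
    (h100 : ∀ n, n < k → 2 * ((((F.P K).d * (((F.P K).L - 1) / 2) : ℕ) : ℝ) * (((((F.P K).d - 1 : ℕ) : ℝ) * (((F.P K).L - 1 : ℕ) : ℝ)) * a n)) ≤ 1 / 100)
    (hguard : ∀ n, n < k →
      2 * ((((F.P K).d * (((F.P K).L - 1) / 2) : ℕ) : ℝ) * (((((F.P K).d - 1 : ℕ) : ℝ) * (((F.P K).L - 1 : ℕ) : ℝ)) * a n)) < (FederbushMean.federbushSU (n := Fin N)).δ)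
    {ω θ : ℝ} (hθ0 : 0 ≤ θ) (hθ : θ ≤ 1 / 2) (hω0 : 0 ≤ ω)
    (hE : ∀ m, m < k → 4 * (2 * ((((F.P K).d * (((F.P K).L - 1) / 2) : ℕ) : ℝ) * (((((F.P K).d - 1 : ℕ) : ℝ) * (((F.P K).L - 1 : ℕ) : ℝ)) * a m))) ≤
      ω / 2 * θ ^ (k - (m + 1))) :
    ∀ t, t ≤ k → ∀ w ∈ S,
      dist1 ((g₁ (embIter t (iterBlockOf t w)) * (g₂ (embIter t (iterBlockOf t w)))⁻¹)⁻¹ * (g₁ w * (g₂ w)⁻¹)) ≤ ω * θ ^ (k - t) := by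
  have h₁ : ∀ n, n < k → ∀ w ∈ S, dist1 (radialHol (Averaging.iter (avOfRecord F N K) n (gaugeAct g₁ U)) (iterBlockOf (n + 1) w) (iterBlockOf n w)) ≤
      4 * (2 * ((((F.P K).d * (((F.P K).L - 1) / 2) : ℕ) : ℝ) * (((((F.P K).d - 1 : ℕ) : ℝ) * (((F.P K).L - 1 : ℕ) : ℝ)) * a n))) := by
    intro n hn w hw
    obtain ⟨t, ht, hbox⟩ := hS₀ n hn w hw
    exact dist1_radialHol_iterBlockOf_le_of_fineBoxPlaqs (by omega) U g₁ (hax₁ n hn) (hN n hn) ha₀ hU w t ht hbox (hbud n hn) (hgd n hn) (ha n) (haa n hn)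
      (h100 n hn) (hguard n hn)
  have h₂ : ∀ n, n < k → ∀ w ∈ S, dist1 (radialHol (Averaging.iter (avOfRecord F N K) n (gaugeAct g₂ U)) (iterBlockOf (n + 1) w) (iterBlockOf n w)) ≤ (0 : ℝ) :=
    fun n hn w _ => (dist1_radialHol_iterBlockOf_eq_zero_of_axialGauge_radial (by omega) _ (hax₂ n hn) w).le
  exact dist1_descent_le_geom (avOfRecord F N K) hk g₁ g₂ U S
    (fun m => 4 * (2 * ((((F.P K).d * (((F.P K).L - 1) / 2) : ℕ) : ℝ) * (((((F.P K).d - 1 : ℕ) : ℝ) * (((F.P K).L - 1 : ℕ) : ℝ)) * a m)))) (fun _ => (0 : ℝ))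
    hθ0 hθ hω0 h₁ h₂ (fun m hm => by rw [zero_add]; exact hE m hm)

end Summit.QuantumFields.YangMills.BalabanUVNodes.N07SymTauTowerStatementOfFinePlaquettes

end
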